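import Literature.Geometry.Riemannian.RicciFlowMetricFlowPair
import Literature.Geometry.Riemannian.RicciFlowHConcentrationHolds
import HarnessLib

/-!
# Bamler's 𝔽-precompactness of Ricci flows (Bamler 2023, §7.1, Thm. 7.4 with Cor. 7.5 and
# Lemma 7.3) — statement

R. Bamler, *Compactness theory of the space of super Ricci flows*, Invent. Math. 233 (2023), §7.1
(arXiv v1 Thm. 155, Cor. 156, Lemma 154): `𝔽^J_I(H, V, b, r)` is a compact subset of
`(𝔽^J_I, d^J_𝔽)` when `I` is a finite interval and `J` is finite (Thm. 155); consequently
(Cor. 156) a sequence of super Ricci flows on compact `n`-manifolds with conjugate heat flows has a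
subsequence whose metric flow pairs converge in the `d^J_𝔽`-sense to a class in
`𝔽^J_I(H_n, V, b, r)`; and (Lemma 154) the pair of a compact Ricci flow with a conjugate heat
KERNEL measure lies in `𝔽^{*,J}_I(H_n)` (so `V = 0`).

This file only STATES the special case used downstream, in the tree's vocabulary
(`ricciFlowMetricFlowPair`, `MetricFlowPair.fDist`, `MetricFlow.IsHConcentrated`), as the named
fact `bamler_FCompactness_ricciFlow`: a sequence of Ricci flows of Riemannian metrics on closed
connected `m`-manifolds over a common `[a, T]`, each paired with the conjugate heat kernel based
at a point of its final slice, has a subsequence converging in `d_𝔽` (`J = ∅`) to an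
`H_m`-concentrated metric flow pair over `[a, T]`. Its proof (§7.2–7.3 of the source over §4–§6)
is not in the tree (cf. the lead's LAYER-B-DESIGN note: general correspondences, §5.2–§6 first).
Users take `(h : bamler_FCompactness_ricciFlow)`.

## References

* R. H. Bamler, *Compactness theory of the space of super Ricci flows*, Invent. Math. 233 (2023),
  1121–1277, §7.1, Thm. 7.4, Cor. 7.5, Lemma 7.3 (arXiv v1: Thm. 155, Cor. 156, Lemma 154).
  [Bamler2023]
-/

noncomputable section

open Set Filter
open scoped Manifold ContDiff Topology ENNReal NNReal

namespace Literature.Geometry.Riemannian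

open Lorentzian Lorentzian.PseudoRiemannianMetric

/-- NAMED FACT (**Bamler 2023, §7.1, Cor. 7.5 with Thm. 7.4 and Lemma 7.3 / arXiv v1 Cor. 156,
Thm. 155, Lemma 154 — 𝔽-precompactness of compact Ricci flows with conjugate heat kernels**):
for `m ≥ 1` and `a < T`, every sequence `k ↦ (M_k, (h_k, cov_k), x_k)` of Ricci flows of smooth
families of Riemannian metrics on closed connected `m`-manifolds (modelled on `ℝᵐ`) over `[a, T]`
with base points `x_k ∈ M_k` has a subsequence `φ` along which the metric flow pairs
`(𝒳^{φ i}, (ν_{x_{φ i}, T; s})_{s ∈ (a,T)})` (`ricciFlowMetricFlowPair`) converge in the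
`𝔽`-distance (`MetricFlowPair.fDist ∅`) to a metric flow pair over `[a, T]` whose flow is
`H_m`-concentrated (`H_m = (m−1)π²/2 + 4`). Special case (`J = ∅`, heat-kernel pairs, so `V = 0`)
of the cited statements; the source moreover identifies the limit up to the conventions of
`𝔽_I(H_n, V, b, r)` and gives uniqueness/future continuity refinements (Thm. 7.6) not stated here.
-- TODO(general form): Thm. 7.4 for `𝔽^J_I(H, V, b, r)` with finite `J`, and Thms. 7.6–7.7.
[cite: Bamler2023, §7.1, Cor. 7.5; Thm. 7.4; Lemma 7.3] -/
def bamler_FCompactness_ricciFlow : Prop :=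
  ∀ (m : ℕ), 0 < m → ∀ (a T : ℝ) (haT : a < T)
    (M : ℕ → Type) [∀ k, TopologicalSpace (M k)]
      [∀ k, ChartedSpace (EuclideanSpace ℝ (Fin m)) (M k)]
      [∀ k, IsManifold 𝓘(ℝ, EuclideanSpace ℝ (Fin m)) ∞ (M k)] [∀ k, T2Space (M k)]
      [∀ k, CompactSpace (M k)] [∀ k, SecondCountableTopology (M k)]
      [∀ k, MeasurableSpace (M k)] [∀ k, BorelSpace (M k)] [∀ k, ConnectedSpace (M k)]
    (h : ∀ k, ℝ → PseudoRiemannianMetric 𝓘(ℝ, EuclideanSpace ℝ (Fin m)) ∞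
      (EuclideanSpace ℝ (Fin m)) (TangentSpace 𝓘(ℝ, EuclideanSpace ℝ (Fin m)) : M k → Type _))
    (cov : ∀ k, ℝ → CovariantDerivative 𝓘(ℝ, EuclideanSpace ℝ (Fin m))
      (EuclideanSpace ℝ (Fin m)) (TangentSpace 𝓘(ℝ, EuclideanSpace ℝ (Fin m)) : M k → Type _))
    (hflow : ∀ k, IsRicciFlow (h k) (cov k) (Icc a T))
    (hh : ∀ k, IsContMDiffFamilyOn ∞ (h k) univ) (hR : ∀ k s, (h k s).IsRiemannian)
    (x : ∀ k, M k),
    ∃ φ : ℕ → ℕ, StrictMono φ ∧ ∃ P : MetricFlowPair.{0} (Icc a T),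
      P.flow.IsHConcentrated (MetricFlow.concentrationConst m) ∧
      Tendsto (fun i ↦ MetricFlowPair.fDist ∅
        (ricciFlowMetricFlowPair (hh (φ i)) (hR (φ i)) (hflow (φ i)) haT (x (φ i))) P)
        atTop (𝓝 0)

/-- **Consequence (conditional on the fact): the consumed form** — along the subsequence the
`𝔽`-distance to the limit is eventually at most any `ε > 0`, and the limit flow is
`H_m`-concentrated. [cite: Bamler2023, §7.1, Cor. 7.5] -/
theorem exists_subseq_fDist_le_of_bamler_FCompactness (hF : bamler_FCompactness_ricciFlow)
    (m : ℕ) (hm : 0 < m) (a T : ℝ) (haT : a < T)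
    (M : ℕ → Type) [∀ k, TopologicalSpace (M k)]
    [∀ k, ChartedSpace (EuclideanSpace ℝ (Fin m)) (M k)]
    [∀ k, IsManifold 𝓘(ℝ, EuclideanSpace ℝ (Fin m)) ∞ (M k)] [∀ k, T2Space (M k)]
    [∀ k, CompactSpace (M k)] [∀ k, SecondCountableTopology (M k)]
    [∀ k, MeasurableSpace (M k)] [∀ k, BorelSpace (M k)] [∀ k, ConnectedSpace (M k)]
    (h : ∀ k, ℝ → PseudoRiemannianMetric 𝓘(ℝ, EuclideanSpace ℝ (Fin m)) ∞
      (EuclideanSpace ℝ (Fin m)) (TangentSpace 𝓘(ℝ, EuclideanSpace ℝ (Fin m)) : M k → Type _))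
    (cov : ∀ k, ℝ → CovariantDerivative 𝓘(ℝ, EuclideanSpace ℝ (Fin m))
      (EuclideanSpace ℝ (Fin m)) (TangentSpace 𝓘(ℝ, EuclideanSpace ℝ (Fin m)) : M k → Type _))
    (hflow : ∀ k, IsRicciFlow (h k) (cov k) (Icc a T))
    (hh : ∀ k, IsContMDiffFamilyOn ∞ (h k) univ) (hR : ∀ k s, (h k s).IsRiemannian)
    (x : ∀ k, M k) :
    ∃ φ : ℕ → ℕ, StrictMono φ ∧ ∃ P : MetricFlowPair.{0} (Icc a T),
      P.flow.IsHConcentrated (MetricFlow.concentrationConst m) ∧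
      ∀ ε : ℝ≥0∞, 0 < ε → ∃ i₀ : ℕ, ∀ i, i₀ ≤ i →
        MetricFlowPair.fDist ∅
          (ricciFlowMetricFlowPair (hh (φ i)) (hR (φ i)) (hflow (φ i)) haT (x (φ i))) P ≤ ε := by
  obtain ⟨φ, hφ, P, hP, hT⟩ := hF m hm a T haT M h cov hflow hh hR x
  refine ⟨φ, hφ, P, hP, fun ε hε ↦ ?_⟩
  exact eventually_atTop.1 (ENNReal.tendsto_nhds_zero.1 hT ε hε)

end Literature.Geometry.Riemannian

end
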